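import Mathlib.MeasureTheory.Measure.Prod
import Mathlib.MeasureTheory.Integral.Lebesgue.Add
import Mathlib.MeasureTheory.Constructions.BorelSpace.Metric
import Mathlib.Topology.Sequences
import Mathlib.Topology.Instances.ENNReal.Lemmas
import HarnessLib

/-!
# Uniformly distributed measures are unique up to a constant (Christensen's lemma)

Support file (all results proved) for the identification of the spherical Hausdorff measure with
the polar-coordinate surface measure (`Literature/MeasureTheory/Hausdorff/SphereMeasure.lean`),
itself a step of Bartnik's existence theorem for the ADM energy
(`Literature.Geometry.Lorentzian.AFEnd.HasADMEnergy_of_isAsymptoticallyFlat`).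

A Borel measure `μ` on a metric space `X` is *uniformly distributed* if the measure of a ball
`μ (B(x, r))` does not depend on its centre `x`. **Christensen's lemma** (Christensen 1970;
Mattila, *Geometry of sets and measures in Euclidean spaces* (1995), Thm. 3.4): two uniformly
distributed (finite, nonzero) Borel measures on a separable metric space are proportional. We
prove it for finite measures on a second-countable pseudometric space:

* `measure_ball_pos_of_measure_ball_eq` — a nonzero uniformly distributed measure charges every
  ball;
* `measure_le_liminf_of_measure_ball_eq` — the one-sided Fatou inequality
  `μ U ≤ liminf_n (μ(B_{s_n}) / ν(B_{s_n})) · ν U` for open `U` and radii `s_n → 0` (Mattila's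
  proof: Fubini on `{(x, y) ∈ U × U | d(x, y) < s}` and Fatou);
* `exists_eq_smul_of_measure_ball_eq` — the lemma: `μ = c • ν` with `c < ∞`.

## References

* P. Mattila, *Geometry of sets and measures in Euclidean spaces*, CUP 1995, Def. 3.3, Thm. 3.4.
* J. P. R. Christensen, *On some measures analogous to Haar measure*, Math. Scand. 26 (1970).
-/

noncomputable section

open Set Filter Function Metric TopologicalSpace
open _root_.MeasureTheory _root_.MeasureTheory.Measure
open scoped ENNReal NNReal Topology

namespace Literature.MeasureTheory.Hausdorff

variable {X : Type*} [PseudoMetricSpace X] [SecondCountableTopology X] [MeasurableSpace X]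
  [BorelSpace X]

omit [BorelSpace X] in
/-- A nonzero measure whose ball measures do not depend on the centre charges every open ball
(a separable space is covered by countably many balls of any fixed radius, all of the same
measure). Mattila 1995, Def. 3.3 (where positivity is part of the definition). [folklore] -/
theorem measure_ball_pos_of_measure_ball_eq (ν : Measure X)
    (hν : ∀ (x y : X) (r : ℝ), ν (ball x r) = ν (ball y r)) (hν0 : ν ≠ 0) (x : X) {r : ℝ}
    (hr : 0 < r) : 0 < ν (ball x r) := by
  obtain ⟨D, hDc, hDd⟩ := exists_countable_dense X
  have hcover : (univ : Set X) ⊆ ⋃ d ∈ D, ball d r := fun y _ ↦ by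
    obtain ⟨d, hdD, hd⟩ := hDd.exists_dist_lt y hr
    exact mem_iUnion₂.2 ⟨d, hdD, mem_ball.2 hd⟩
  refine pos_iff_ne_zero.2 fun h0 ↦ hν0 ?_
  rw [← measure_univ_eq_zero]
  refine le_antisymm ((measure_mono hcover).trans ?_) bot_le
  refine (measure_biUnion_le ν hDc _).trans ?_
  have h : ∀ p : D, ν (ball (p : X) r) = 0 := fun p ↦ by rw [hν _ x r, h0]
  simp [h]

/-- **Mattila's one-sided inequality.** Let `μ`, `ν` be finite measures on a second-countable
pseudometric space whose ball measures do not depend on the centre, `x₀` a point, `s_n → 0`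
positive radii with `ν (B(x₀, s_n)) ≠ 0`. Then for every open set `U`,
`μ U ≤ liminf_n (μ (B(x₀, s_n)) / ν (B(x₀, s_n))) · ν U`. Proof (Mattila 1995, proof of
Thm. 3.4): by Fubini `∫_U ν(U ∩ B(x, s)) dμ(x) = ∫_U μ(U ∩ B(y, s)) dν(y) ≤ μ(B_s) ν(U)`, while
`ν(U ∩ B(x, s_n)) / ν(B_{s_n}) = 1` for `n` large at every `x ∈ U`; conclude by Fatou.
[cite: Mattila1995, Thm. 3.4] -/
theorem measure_le_liminf_of_measure_ball_eq (μ ν : Measure X) [IsFiniteMeasure μ]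
    [IsFiniteMeasure ν] (hμ : ∀ (x y : X) (r : ℝ), μ (ball x r) = μ (ball y r))
    (hν : ∀ (x y : X) (r : ℝ), ν (ball x r) = ν (ball y r)) (x₀ : X) {s : ℕ → ℝ}
    (hs0 : Tendsto s atTop (𝓝 0)) (hpos : ∀ n, ν (ball x₀ (s n)) ≠ 0) {U : Set X}
    (hU : IsOpen U) :
    μ U ≤ liminf (fun n ↦ μ (ball x₀ (s n)) / ν (ball x₀ (s n)) * ν U) atTop := by
  -- the sets `S n = {(x, y) ∈ U × U | dist x y < s n}` and their slices
  set S : ℕ → Set (X × X) := fun n ↦ {p | p.1 ∈ U ∧ p.2 ∈ U ∧ dist p.1 p.2 < s n} with hS_def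
  have hS : ∀ n, MeasurableSet (S n) := fun n ↦ by
    refine IsOpen.measurableSet ?_
    exact (hU.preimage continuous_fst).inter ((hU.preimage continuous_snd).inter
      (isOpen_lt continuous_dist continuous_const))
  have slice₁ : ∀ n x, x ∈ U → Prod.mk x ⁻¹' S n = U ∩ ball x (s n) := fun n x hx ↦ by
    ext y
    simp only [hS_def, mem_preimage, mem_setOf_eq, mem_inter_iff, mem_ball]
    rw [dist_comm]
    tauto
  have slice₁' : ∀ n x, x ∉ U → Prod.mk x ⁻¹' S n = ∅ := fun n x hx ↦ by
    ext y
    simp only [hS_def, mem_preimage, mem_setOf_eq, mem_empty_iff_false, iff_false]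
    tauto
  have slice₂ : ∀ n y, y ∈ U → (fun x ↦ (x, y)) ⁻¹' S n = U ∩ ball y (s n) := fun n y hy ↦ by
    ext x
    simp only [hS_def, mem_preimage, mem_setOf_eq, mem_inter_iff, mem_ball]
    tauto
  have slice₂' : ∀ n y, y ∉ U → (fun x ↦ (x, y)) ⁻¹' S n = ∅ := fun n y hy ↦ by
    ext x
    simp only [hS_def, mem_preimage, mem_setOf_eq, mem_empty_iff_false, iff_false]
    tauto
  -- the Fatou integrands
  set f : ℕ → X → ℝ≥0∞ := fun n x ↦ ν (Prod.mk x ⁻¹' S n) * (ν (ball x₀ (s n)))⁻¹ with hf_def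
  have hf : ∀ n, Measurable (f n) := fun n ↦
    (measurable_measure_prodMk_left (hS n)).mul_const _
  -- (1) lower bound: on `U`, `f n x = 1` for `n` large
  have hlow : ∀ x, U.indicator 1 x ≤ liminf (fun n ↦ f n x) atTop := by
    intro x
    by_cases hx : x ∈ U
    · rw [indicator_of_mem hx, Pi.one_apply]
      obtain ⟨ε, hε, hεU⟩ := Metric.isOpen_iff.1 hU x hx
      have hev : ∀ᶠ n in atTop, f n x = 1 := by
        have h1 : ∀ᶠ n in atTop, s n < ε := hs0.eventually (gt_mem_nhds hε)
        filter_upwards [h1] with n hn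
        have hball : U ∩ ball x (s n) = ball x (s n) :=
          inter_eq_right.2 ((ball_subset_ball hn.le).trans hεU)
        simp only [hf_def]
        rw [slice₁ n x hx, hball, hν x x₀, ENNReal.mul_inv_cancel (hpos n) (measure_ne_top _ _)]
      rw [liminf_congr hev, liminf_const]
    · rw [indicator_of_notMem hx]
      exact bot_le
  -- (2) upper bound: `∫ f n dμ ≤ μ(B_{s n}) / ν(B_{s n}) * ν U`
  have hup : ∀ n, ∫⁻ x, f n x ∂μ ≤ μ (ball x₀ (s n)) / ν (ball x₀ (s n)) * ν U := by
    intro n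
    have hswap : ∫⁻ x, ν (Prod.mk x ⁻¹' S n) ∂μ = ∫⁻ y, μ ((fun x ↦ (x, y)) ⁻¹' S n) ∂ν := by
      have h1 : ∀ x, ν (Prod.mk x ⁻¹' S n) = ∫⁻ y, (S n).indicator 1 (x, y) ∂ν := fun x ↦ by
        rw [← lintegral_indicator_one (measurable_prodMk_left (hS n))]
        rfl
      have h2 : ∀ y, μ ((fun x ↦ (x, y)) ⁻¹' S n) = ∫⁻ x, (S n).indicator 1 (x, y) ∂μ :=
        fun y ↦ by
        rw [← lintegral_indicator_one (measurable_prodMk_right (hS n))]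
        rfl
      simp_rw [h1, h2]
      exact lintegral_lintegral_swap ((measurable_one.indicator (hS n)).aemeasurable)
    have hbound : ∀ y, μ ((fun x ↦ (x, y)) ⁻¹' S n) ≤
        U.indicator (fun _ ↦ μ (ball x₀ (s n))) y := by
      intro y
      by_cases hy : y ∈ U
      · rw [slice₂ n y hy, indicator_of_mem hy, ← hμ y x₀ (s n)]
        exact measure_mono inter_subset_right
      · rw [slice₂' n y hy, measure_empty]
        exact bot_le
    calc ∫⁻ x, f n x ∂μ
        = (∫⁻ x, ν (Prod.mk x ⁻¹' S n) ∂μ) * (ν (ball x₀ (s n)))⁻¹ :=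
          lintegral_mul_const _ (measurable_measure_prodMk_left (hS n))
      _ ≤ (∫⁻ y, U.indicator (fun _ ↦ μ (ball x₀ (s n))) y ∂ν) * (ν (ball x₀ (s n)))⁻¹ := by
          rw [hswap]
          exact mul_le_mul' (lintegral_mono hbound) le_rfl
      _ = μ (ball x₀ (s n)) * ν U * (ν (ball x₀ (s n)))⁻¹ := by
          rw [lintegral_indicator_const hU.measurableSet]
      _ = μ (ball x₀ (s n)) / ν (ball x₀ (s n)) * ν U := by
          rw [div_eq_mul_inv, mul_right_comm]
  -- (3) Fatou
  calc μ U = ∫⁻ x, U.indicator 1 x ∂μ := (lintegral_indicator_one hU.measurableSet).symm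
    _ ≤ ∫⁻ x, liminf (fun n ↦ f n x) atTop ∂μ := lintegral_mono hlow
    _ ≤ liminf (fun n ↦ ∫⁻ x, f n x ∂μ) atTop := lintegral_liminf_le hf
    _ ≤ liminf (fun n ↦ μ (ball x₀ (s n)) / ν (ball x₀ (s n)) * ν U) atTop :=
        liminf_le_liminf (Eventually.of_forall hup)

/-- **Christensen's lemma** (uniqueness of uniformly distributed measures; Christensen 1970;
Mattila, *Geometry of sets and measures in Euclidean spaces* (1995), Thm. 3.4, for finite
measures). Let `μ`, `ν` be finite Borel measures on a second-countable pseudometric space such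
that `μ (B(x, r))` and `ν (B(x, r))` do not depend on the centre `x`, and `ν ≠ 0`. Then
`μ = c • ν` for a constant `c < ∞`. Proof: along radii `s_k → 0` for which the ratios
`μ(B_{s_k}) / ν(B_{s_k})` converge to some `q ∈ [0, ∞]`, the one-sided inequality gives
`μ U ≤ q ν U` and `ν U ≤ q⁻¹ μ U` for all open `U`; finiteness and `μ, ν ≠ 0` force `0 < q < ∞`
and `μ U = q ν U`, and finite Borel measures agreeing on open sets agree.
[cite: Mattila1995, Thm. 3.4] -/
theorem exists_eq_smul_of_measure_ball_eq (μ ν : Measure X) [IsFiniteMeasure μ]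
    [IsFiniteMeasure ν] (hμ : ∀ (x y : X) (r : ℝ), μ (ball x r) = μ (ball y r))
    (hν : ∀ (x y : X) (r : ℝ), ν (ball x r) = ν (ball y r)) (hν0 : ν ≠ 0) :
    ∃ c : ℝ≥0∞, c ≠ ∞ ∧ μ = c • ν := by
  by_cases hμ0 : μ = 0
  · exact ⟨0, ENNReal.zero_ne_top, by rw [hμ0, zero_smul]⟩
  -- a base point and the ball functions
  have hne : Nonempty X := by
    by_contra h
    rw [not_nonempty_iff] at h
    exact hν0 (eq_zero_of_isEmpty ν)
  obtain ⟨x₀⟩ := hne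
  set g : ℝ → ℝ≥0∞ := fun r ↦ μ (ball x₀ r) with hg_def
  set h : ℝ → ℝ≥0∞ := fun r ↦ ν (ball x₀ r) with hh_def
  have hgpos : ∀ r, 0 < r → g r ≠ 0 := fun r hr ↦
    (measure_ball_pos_of_measure_ball_eq μ hμ hμ0 x₀ hr).ne'
  have hhpos : ∀ r, 0 < r → h r ≠ 0 := fun r hr ↦
    (measure_ball_pos_of_measure_ball_eq ν hν hν0 x₀ hr).ne'
  -- radii `t n = 1/(n+1)` and a subsequence along which `g/h` converges in `[0, ∞]`
  set t : ℕ → ℝ := fun n ↦ 1 / ((n : ℝ) + 1) with ht_def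
  have htpos : ∀ n, 0 < t n := fun n ↦ by positivity
  have ht0 : Tendsto t atTop (𝓝 0) := tendsto_one_div_add_atTop_nhds_zero_nat
  obtain ⟨q, -, φ, hφ, hq⟩ := (isCompact_Icc (a := (0 : ℝ≥0∞)) (b := ⊤)).tendsto_subseq
    (x := fun n ↦ g (t n) / h (t n)) fun n ↦ ⟨bot_le, le_top⟩
  set s : ℕ → ℝ := t ∘ φ with hs_def
  have hspos : ∀ k, 0 < s k := fun k ↦ htpos _
  have hs0 : Tendsto s atTop (𝓝 0) := ht0.comp hφ.tendsto_atTop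
  have hq' : Tendsto (fun k ↦ g (s k) / h (s k)) atTop (𝓝 q) := hq
  have hqinv : Tendsto (fun k ↦ h (s k) / g (s k)) atTop (𝓝 q⁻¹) := by
    have h1 : Tendsto (fun k ↦ (g (s k) / h (s k))⁻¹) atTop (𝓝 q⁻¹) := hq'.inv
    refine h1.congr fun k ↦ ?_
    rw [ENNReal.inv_div (Or.inl (measure_ne_top _ _)) (Or.inl (hhpos _ (hspos k)))]
  -- the two one-sided inequalities on open sets
  have hle₁ : ∀ U : Set X, IsOpen U → μ U ≤ q * ν U := by
    intro U hU
    have hlim : Tendsto (fun k ↦ g (s k) / h (s k) * ν U) atTop (𝓝 (q * ν U)) :=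
      ENNReal.Tendsto.mul_const hq' (Or.inr (measure_ne_top _ _))
    have := measure_le_liminf_of_measure_ball_eq μ ν hμ hν x₀ hs0
      (fun k ↦ hhpos _ (hspos k)) hU
    rwa [hlim.liminf_eq] at this
  have hle₂ : ∀ U : Set X, IsOpen U → ν U ≤ q⁻¹ * μ U := by
    intro U hU
    have hlim : Tendsto (fun k ↦ h (s k) / g (s k) * μ U) atTop (𝓝 (q⁻¹ * μ U)) :=
      ENNReal.Tendsto.mul_const hqinv (Or.inr (measure_ne_top _ _))
    have := measure_le_liminf_of_measure_ball_eq ν μ hν hμ x₀ hs0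
      (fun k ↦ hgpos _ (hspos k)) hU
    rwa [hlim.liminf_eq] at this
  -- `0 < q < ∞`
  have hq0 : q ≠ 0 := by
    intro hq0
    have h1 := hle₁ univ isOpen_univ
    rw [hq0, zero_mul, nonpos_iff_eq_zero, measure_univ_eq_zero] at h1
    exact hμ0 h1
  have hqtop : q ≠ ∞ := by
    intro hqt
    have h1 := hle₂ univ isOpen_univ
    rw [hqt, ENNReal.inv_top, zero_mul, nonpos_iff_eq_zero, measure_univ_eq_zero] at h1
    exact hν0 h1
  -- equality on open sets, hence everywhere
  have heq : ∀ U : Set X, IsOpen U → μ U = (q • ν) U := by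
    intro U hU
    rw [Measure.smul_apply, smul_eq_mul]
    refine le_antisymm (hle₁ U hU) ?_
    have h2 := hle₂ U hU
    calc q * ν U ≤ q * (q⁻¹ * μ U) := by gcongr
      _ = μ U := by rw [← mul_assoc, ENNReal.mul_inv_cancel hq0 hqtop, one_mul]
  refine ⟨q, hqtop, ?_⟩
  haveI : IsFiniteMeasure (q • ν) := by
    refine ⟨?_⟩
    rw [Measure.smul_apply, smul_eq_mul]
    exact ENNReal.mul_lt_top hqtop.lt_top (measure_lt_top _ _)
  refine ext_of_generate_finite _ (BorelSpace.measurable_eq (α := X)) isPiSystem_isOpen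
    (fun U hU ↦ heq U hU) (heq univ isOpen_univ)

end Literature.MeasureTheory.Hausdorff

end
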